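/-
Copyright (c) 2026 the pub-hodgecm-mathlib formalisation cell (harness21).  Prover seat hodgecm-mathlib-LH6-p04 (g3), road (D) owner of record;
crux H413 = stmt-HodgeConjecture-24833; 2026-09-02.
-/
import Summits.HodgeConjecture.HodgeConjecture.Theorems.F0P3cStCharTSHshellGlue                  -- ★ p850340 (LH7-p03) `hOHj_xig_of_hF1H` (∘ ★ p850219 ② ∘ ★ p850188 HOH-FLIP)
import Summits.HodgeConjecture.HodgeConjecture.Theorems.F0P3cStCharTSFlipDominant                -- ★ p850152 (F0P3-p01) `exists_eq_diagonal_weylConj_of_oriented`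
import Summits.HodgeConjecture.HodgeConjecture.Theorems.F0P3cStCharTSDomGeneralHPkg              -- ★ p850025∕p850121 (A-p16) `domGeneralH_of_inst`
import Summits.HodgeConjecture.HodgeConjecture.Theorems.F0P3cU2PrincipalSeriesJacquetFiltration  -- ★ p849815 (LH5-p05) W2-c `u2PrincipalSeries_jacquetFiltration`
import Summits.HodgeConjecture.HodgeConjecture.Theorems.F0P3cStCharTSConstants                   -- ★ p850071 (F0P2-p06) Haar-positivity helpers
import Literature.NumberTheory.Automorphic.UnitOrbitalIntegralFixedPointsPair                    -- ★ `cmLocalIntegralLevel_one_eq_top_of_smul_eq`, `compactSpace_cmDatum_local_one_of_smul_eq`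
import Literature.NumberTheory.Automorphic.LocalUnitaryIntegralLevel                             -- ★ `isUnit_placeForm_antidiagOne`
import HarnessLib

/-!
# F0 · P3c · line LH6 «StCharTS» — road (D) «DEEP-FL», (D-c) HEAD «XIG-ASSEMBLY», the `H`-PACKAGE

Cell `pub/hodgecm-mathlib`, crux H413 = `stmt-HodgeConjecture-24833` (lane `--supports … --as helper`), route HCCMUnconditional; road-(D) owner LH6-p04 (g3).
THEOREMS ONLY, sorry-free, ★-only imports; no definition ∕ instance ∕ notation ∕ named fact.  HONEST LABEL: HC_CM is proved only modulo the 7 printed citations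
(2 remaining: hLiu418 = stmt-HodgeConjecture-24832, h413 = stmt-HodgeConjecture-24833) until rung 0 closes; count-neutral plumbing for the (D-c) head.

THE MATHEMATICS ([Rogawski1990, §4.9 (4.9.4) p. 56; §12.1 pp. 171–172; §12.7 Lemma 12.7.3 (proof) p. 195]; [Casselman1995, Prop. 1.4.4, §6.3]).  The (OH) third of the
transfer checklist ★ `isLocalDeltaTransfer_doubleCosetSum_of_checklist` for the refined `H`-test function `f^H₀ = Σ_{u ∈ F} c_u 𝟙_{K_H (u₁,u₂) K_H}` needs, per oriented
representative `u ∈ F ⊆ T₂ × U(Φ₁)_v`, the closed form of the orbital integrals of `𝟙_{K_H (u₁,u₂) K_H}` on the hyperbolic Levi stratum.  ★ HSHELL-GLUE (p850340) delivers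
it GIVEN the dominance triple and a transversal at the Weyl flip `w₀ u₁ w₀⁻¹`, the 2-step Jacquet datum of `i₂(χ₁ ⊠ χ₂)`, and the integrality of `U(Φ₁)_v`.  This file
DISCHARGES those inputs once and for all for the `H`-datum of ★ `exists_cmIwahoriDatum₂` (principal-congruence levels along the ray `d(α, (σα)⁻¹)`, `|α| < 1`):
dominance at the flips is ★ DomGeneralHPkg `domGeneralH_of_inst` (every `E₂`-diagonal `d(e₀, e₁)` with `|e₀| < |e₁|` is dominant at every level, with a finite
transversal), the flip of an ORIENTED rep (`|d′₁| < |d′₀|`) is such a diagonal (★ FLIP-DOMINANT), the Jacquet datum is ★ W2-c, `U(Φ₁)_v = U(Φ₁)(𝒪_v)` at a non-split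
place (★ `cmLocalIntegralLevel_one_eq_top_of_smul_eq`), and the constant `κ_H(u) ≠ 0` by Haar positivity of compact open boxes, `#R₂ ≠ 0`, `δ ≠ 0` (★ CONSTANTS).
The output is packaged EXISTENTIALLY in `(R₂, κH, κ′, C′)` with the closed forms recorded as equations, so the head reads the (OH) clause by name (no β-reduction of
kilobyte-long constants inside the head's one declaration — the measured `whnf` budget of the head).
* `hPackageH` — `∃ R₂ κH κ′ C′`, transversals `hR₂`, the `hOHj` clause of ★ p849876 VERBATIM at `s := F`, `g u := 𝟙_{K_H (u₁,u₂) K_H}`, `C u := u • ↑S′`,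
  `κH u ≠ 0`, `C′ u = (w₀u₁w₀⁻¹, u₂) • ↑S′`, `κ′ u = 1`, and `κH u =` ★ HSHELL-GLUE's constant.

## References
* [Rogawski1990] J. D. Rogawski, *Automorphic Representations of Unitary Groups in Three Variables*, Ann. of Math. Stud. 123 (1990): §4.9 (4.9.4) pp. 54–56;
  §12.1 pp. 171–172; §12.7 Lemma 12.7.3 (proof) p. 195.
* [Casselman1995] W. Casselman, *Introduction to the theory of admissible representations of 𝔭-adic reductive groups* (1995 notes), Prop. 1.4.4 p. 14; §6.3.
-/

set_option autoImplicit false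
-- the mandated namespace has the single-problem summit's repeated segment (`HodgeConjecture.HodgeConjecture`)
set_option linter.dupNamespace false

noncomputable section

open NumberField IsDedekindDomain MeasureTheory MeasureTheory.Measure Topology
open scoped Matrix MatrixGroups NNReal ENNReal Pointwise
open Literature.MeasureTheory.Group
open Literature.NumberTheory Literature.NumberTheory.Automorphic Literature.NumberTheory.Automorphic.UnitaryGroup
open Literature.NumberTheory.Automorphic.UnitaryGroup.HeisRing Literature.NumberTheory.Automorphic.UnitaryGroup.LineRing
open Literature.NumberTheory.Rogawski1990 Literature.NumberTheory.GaloisRepresentations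
open Summit.HodgeConjecture.HodgeConjecture.Cruxes.H413.F0P3cCMLocalNonsplitBorelTransportU2

namespace Summit.HodgeConjecture.HodgeConjecture.Cruxes.H413.F0P3cStCharTSXIGHPackage

variable (L : Type) [Field L] [NumberField L] [IsCMField L] (v : HeightOneSpectrum (𝓞 ↥(maximalRealSubfield L)))

set_option maxHeartbeats 4000000 in  -- statement-level `whnf` on the CM carriers (same class as ★ p850340 ∕ ★ p850219 ∕ ★ p849876)
set_option synthInstance.maxHeartbeats 400000 in
/-- **The `H`-PACKAGE of the (D-c) head «XIG-ASSEMBLY»**: for the `H`-datum `𝓘₂` of ★ `exists_cmIwahoriDatum₂` (its principal-congruence clause `hK₂I` and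
opposite-radical clause `hNbarI`), a level `n`, a compact open `K₁ ≤ U(Φ₁)_v`, the Weyl element `w₀ ∈ K₀` normalising `K_{2,n}` (`hKw`), and a finite family `F` of
ORIENTED torus representatives (`hrepF`: `u₁ = d(d′₀, d′₁)`, `|d′₁|_w < |d′₀|_w`): there are transversals `R₂ u` of `K_{2,n} ∕ (K_{2,n} ∩ ᵇK_{2,n})` at the flips
`b = w₀u₁w₀⁻¹` and letters `(κH, κ′, C′)` such that the (OH) clause `hOHj` of ★ `isLocalDeltaTransfer_doubleCosetSum_of_checklist` holds VERBATIM at `s := F`,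
`g u := 𝟙_{K_H (u₁,u₂) K_H}` (`K_H = K_{2,n} × K₁`), `C u := u • ↑((T₂ ∩ K_{2,n}) × K₁)`, with `κH u ≠ 0`, `C′ u = (w₀u₁w₀⁻¹, u₂) • ↑((T₂ ∩ K_{2,n}) × K₁)`, `κ′ u = 1`
and `κH u = ν_H(K_{2,n} × U(Φ₁)_v)·#R₂(u)·δ_{B₂}^{1∕2}(w₀u₁w₀⁻¹)·μ_T{T₂ ∩ K_{2,v}}∕μ_T(T₂ ∩ K_{2,n})` (★ HSHELL-GLUE p850340 ∘ ★ DomGeneralHPkg ∘ ★ FLIP-DOMINANT ∘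
★ W2-c ∘ ★ CONSTANTS).  [cite: Rogawski1990, §4.9 (4.9.4) p. 56, §12.7 Lemma 12.7.3 (proof) p. 195] [cite: Casselman1995, Prop. 1.4.4 p. 14, §6.3] -/
theorem hPackageH
    [mHH : MeasurableSpace (((cmDatum L 2 (Matrix.of fun i j : Fin 2 => if i.val + j.val + 1 = 2 then (1 : L) else 0)).Local v) × ((cmDatum L 1 (Matrix.of fun i j : Fin 1 => if i.val + j.val + 1 = 1 then (1 : L) else 0)).Local v))] [BorelSpace (((cmDatum L 2 (Matrix.of fun i j : Fin 2 => if i.val + j.val + 1 = 2 then (1 : L) else 0)).Local v) × ((cmDatum L 1 (Matrix.of fun i j : Fin 1 => if i.val + j.val + 1 = 1 then (1 : L) else 0)).Local v))]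
    [∀ aH : (((cmDatum L 2 (Matrix.of fun i j : Fin 2 => if i.val + j.val + 1 = 2 then (1 : L) else 0)).Local v) × ((cmDatum L 1 (Matrix.of fun i j : Fin 1 => if i.val + j.val + 1 = 1 then (1 : L) else 0)).Local v)), MeasurableSpace ((((cmDatum L 2 (Matrix.of fun i j : Fin 2 => if i.val + j.val + 1 = 2 then (1 : L) else 0)).Local v) × ((cmDatum L 1 (Matrix.of fun i j : Fin 1 => if i.val + j.val + 1 = 1 then (1 : L) else 0)).Local v)) ⧸ Subgroup.centralizer ({aH} : Set (((cmDatum L 2 (Matrix.of fun i j : Fin 2 => if i.val + j.val + 1 = 2 then (1 : L) else 0)).Local v) × ((cmDatum L 1 (Matrix.of fun i j : Fin 1 => if i.val + j.val + 1 = 1 then (1 : L) else 0)).Local v))))]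
    [∀ aH : (((cmDatum L 2 (Matrix.of fun i j : Fin 2 => if i.val + j.val + 1 = 2 then (1 : L) else 0)).Local v) × ((cmDatum L 1 (Matrix.of fun i j : Fin 1 => if i.val + j.val + 1 = 1 then (1 : L) else 0)).Local v)), BorelSpace ((((cmDatum L 2 (Matrix.of fun i j : Fin 2 => if i.val + j.val + 1 = 2 then (1 : L) else 0)).Local v) × ((cmDatum L 1 (Matrix.of fun i j : Fin 1 => if i.val + j.val + 1 = 1 then (1 : L) else 0)).Local v)) ⧸ Subgroup.centralizer ({aH} : Set (((cmDatum L 2 (Matrix.of fun i j : Fin 2 => if i.val + j.val + 1 = 2 then (1 : L) else 0)).Local v) × ((cmDatum L 1 (Matrix.of fun i j : Fin 1 => if i.val + j.val + 1 = 1 then (1 : L) else 0)).Local v))))]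
    [MeasurableSpace ↥(unitaryGroupOfForm (conjLocal L (IsCMField.complexConj L) v) (cmLocalForm L 2 v))] [BorelSpace ↥(unitaryGroupOfForm (conjLocal L (IsCMField.complexConj L) v) (cmLocalForm L 2 v))] [MeasurableSpace ((cmDatum L 1 (Matrix.of fun i j : Fin 1 => if i.val + j.val + 1 = 1 then (1 : L) else 0)).Local v)] [BorelSpace ((cmDatum L 1 (Matrix.of fun i j : Fin 1 => if i.val + j.val + 1 = 1 then (1 : L) else 0)).Local v)]
    (w : PlacesOver L v) (hw : IsCMField.complexConj L • w.1 = w.1)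
    (νH : Measure (((cmDatum L 2 (Matrix.of fun i j : Fin 2 => if i.val + j.val + 1 = 2 then (1 : L) else 0)).Local v) × ((cmDatum L 1 (Matrix.of fun i j : Fin 1 => if i.val + j.val + 1 = 1 then (1 : L) else 0)).Local v))) [νH.IsHaarMeasure] [νH.IsMulRightInvariant]
    {mH : OrbitalMeasureFamily (((cmDatum L 2 (Matrix.of fun i j : Fin 2 => if i.val + j.val + 1 = 2 then (1 : L) else 0)).Local v) × ((cmDatum L 1 (Matrix.of fun i j : Fin 1 => if i.val + j.val + 1 = 1 then (1 : L) else 0)).Local v))} (hmH : mH.IsCanonical (IsLocalGRegular L v) νH)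
    (μT : Measure ↥(cmBorelTriple L 2 v).M) [μT.IsHaarMeasure]
    (𝓘₂ : (cmBorelTriple L 2 v).IwahoriDatum) (n : ℕ)
    (K₁ : Subgroup ((cmDatum L 1 (Matrix.of fun i j : Fin 1 => if i.val + j.val + 1 = 1 then (1 : L) else 0)).Local v)) (hK₁o : IsOpen (K₁ : Set ((cmDatum L 1 (Matrix.of fun i j : Fin 1 => if i.val + j.val + 1 = 1 then (1 : L) else 0)).Local v))) (hK₁c : IsCompact (K₁ : Set ((cmDatum L 1 (Matrix.of fun i j : Fin 1 => if i.val + j.val + 1 = 1 then (1 : L) else 0)).Local v)))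
    (w₀ : ↥(unitaryGroupOfForm (conjLocal L (IsCMField.complexConj L) v) (cmLocalForm L 2 v))) (hw₀ : Units.val (w₀ : GL (Fin 2) (LocalRing L v)) = cmLocalForm L 2 v)
    (hKw : ∀ κ ∈ 𝓘₂.K n, w₀ * κ * w₀⁻¹ ∈ 𝓘₂.K n)
    (F : Finset (↥(cmBorelTriple L 2 v).M × ((cmDatum L 1 (Matrix.of fun i j : Fin 1 => if i.val + j.val + 1 = 1 then (1 : L) else 0)).Local v)))
    (hns : ∀ w' : PlacesOver L v, IsCMField.complexConj L • w'.1 = w'.1)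
    {α : w.1.adicCompletion L} (hα0 : α ≠ 0) (hα1 : Valued.v α < 1)
    (hK₂I : ∀ n, 𝓘₂.K n = ((congruenceGL 2 (ValuativeRel.valuation (w.1.adicCompletion L) α ^ (n + 1))).comap
          (unitaryGroupOfForm (galAdicCompletionMap (L := L) (IsCMField.complexConj L) hw)
            (placeForm (Matrix.of fun i j : Fin 2 => if i.val + j.val + 1 = 2 then (1 : L) else 0) w.1)).subtype).comap
        (localNonsplitEquiv (IsCMField.complexConj L) (Matrix.of fun i j : Fin 2 => if i.val + j.val + 1 = 2 then (1 : L) else 0)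
            (IsCMField.complexConj_ne_one L) w hw :
          «local» L (IsCMField.complexConj L) 2 (Matrix.of fun i j : Fin 2 => if i.val + j.val + 1 = 2 then (1 : L) else 0) v →*
            ↥(unitaryGroupOfForm (galAdicCompletionMap (L := L) (IsCMField.complexConj L) hw)
              (placeForm (Matrix.of fun i j : Fin 2 => if i.val + j.val + 1 = 2 then (1 : L) else 0) w.1))))
    (hNbarI : 𝓘₂.Nbar = (((borelTriple (galAdicCompletionMap (L := L) (IsCMField.complexConj L) hw)
          (placeForm (Matrix.of fun i j : Fin 2 => if i.val + j.val + 1 = 2 then (1 : L) else 0) w.1) (placeForm_antidiagTwo_eq L v w)).N).map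
          (MulAut.conj (weylLongU (galAdicCompletionMap (L := L) (IsCMField.complexConj L) hw) (placeForm_antidiagTwo_eq L v w))).toMonoidHom).comap
        (localNonsplitEquiv (IsCMField.complexConj L) (Matrix.of fun i j : Fin 2 => if i.val + j.val + 1 = 2 then (1 : L) else 0)
            (IsCMField.complexConj_ne_one L) w hw :
          «local» L (IsCMField.complexConj L) 2 (Matrix.of fun i j : Fin 2 => if i.val + j.val + 1 = 2 then (1 : L) else 0) v →*
            ↥(unitaryGroupOfForm (galAdicCompletionMap (L := L) (IsCMField.complexConj L) hw)
              (placeForm (Matrix.of fun i j : Fin 2 => if i.val + j.val + 1 = 2 then (1 : L) else 0) w.1))))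
    (hrepF : ∀ u ∈ F, ∃ d' : Fin 2 → (LocalRing L v)ˣ,
      glDiagonal 2 (LocalRing L v) d' = ((u.1 : ↥(unitaryGroupOfForm (conjLocal L (IsCMField.complexConj L) v) (cmLocalForm L 2 v))) : GL (Fin 2) (LocalRing L v)) ∧
      Valued.v (((d' 1 : (LocalRing L v)ˣ) : LocalRing L v) w) < Valued.v (((d' 0 : (LocalRing L v)ˣ) : LocalRing L v) w)) :
    ∃ (R₂ : (↥(cmBorelTriple L 2 v).M × ((cmDatum L 1 (Matrix.of fun i j : Fin 1 => if i.val + j.val + 1 = 1 then (1 : L) else 0)).Local v)) → Finset ↥(unitaryGroupOfForm (conjLocal L (IsCMField.complexConj L) v) (cmLocalForm L 2 v))) (κH κ' : (↥(cmBorelTriple L 2 v).M × ((cmDatum L 1 (Matrix.of fun i j : Fin 1 => if i.val + j.val + 1 = 1 then (1 : L) else 0)).Local v)) → ℂ) (C' : (↥(cmBorelTriple L 2 v).M × ((cmDatum L 1 (Matrix.of fun i j : Fin 1 => if i.val + j.val + 1 = 1 then (1 : L) else 0)).Local v)) → Set (↥(cmBorelTriple L 2 v).M × ((cmDatum L 1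 (Matrix.of fun i j : Fin 1 => if i.val + j.val + 1 = 1 then (1 : L) else 0)).Local v))),
    (∀ u ∈ F, IsLeftTransversal (𝓘₂.K n) (𝓘₂.K n ⊓ ConjAct.toConjAct (w₀ * (u.1 : ↥(unitaryGroupOfForm (conjLocal L (IsCMField.complexConj L) v) (cmLocalForm L 2 v))) * w₀⁻¹) • 𝓘₂.K n) (R₂ u)) ∧
    (∀ u ∈ F, ∀ (γH : (((cmDatum L 2 (Matrix.of fun i j : Fin 2 => if i.val + j.val + 1 = 2 then (1 : L) else 0)).Local v) × ((cmDatum L 1 (Matrix.of fun i j : Fin 1 => if i.val + j.val + 1 = 1 then (1 : L) else 0)).Local v)))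
      (d' : Fin 2 → (LocalRing L v)ˣ), glDiagonal 2 (LocalRing L v) d' = ((γH.1).val : GL (Fin 2) (LocalRing L v)) → IsLocalGRegular L v γH →
      Valued.v (((d' 1 : (LocalRing L v)ˣ) : LocalRing L v) w) < Valued.v (((d' 0 : (LocalRing L v)ˣ) : LocalRing L v) w) →
      galAdicCompletionMap (L := L) (IsCMField.complexConj L) hw (((d' 0 : (LocalRing L v)ˣ) : LocalRing L v) w) * ((d' 1 : (LocalRing L v)ˣ) : LocalRing L v) w = 1 →
      ∀ (tH : ↥(cmBorelTriple L 2 v).M), (tH : ↥(unitaryGroupOfForm (conjLocal L (IsCMField.complexConj L) v) (cmLocalForm L 2 v))) = γH.1 →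
      ∀ (hdH : glDiagonal 2 (LocalRing L v) d' = ((tH : ↥(unitaryGroupOfForm (conjLocal L (IsCMField.complexConj L) v) (cmLocalForm L 2 v))) : GL (Fin 2) (LocalRing L v)))
        (hb : IsUnit ((((d' 0)⁻¹ * d' 1 : (LocalRing L v)ˣ) : LocalRing L v) - 1)),
      haveI := locallyCompactSpace_cmBorelU L 2 v
      classOrbitalIntegral mH ((DoubleCoset.doubleCoset (((u.1 : ↥(unitaryGroupOfForm (conjLocal L (IsCMField.complexConj L) v) (cmLocalForm L 2 v))), u.2) : (↥(unitaryGroupOfForm (conjLocal L (IsCMField.complexConj L) v) (cmLocalForm L 2 v)) × ((cmDatum L 1 (Matrix.of fun i j : Fin 1 => if i.val + j.val + 1 = 1 then (1 : L) else 0)).Local v))) ((((𝓘₂.K n).prod K₁ : Subgroup (↥(unitaryGroupOfForm (conjLocal L (IsCMField.complexConj L) v) (cmLocalForm L 2 v)) × ((cmDatum L 1 (Matrix.of fun i j : Fin 1 => if i.val + j.val + 1 = 1 then (1 : L) else 0)).Local v)))) : Set (↥(unitaryGroupOfForm (conjLocal L (IsCMField.complexConj L) v) (cmLocalForm L 2 v))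 × ((cmDatum L 1 (Matrix.of fun i j : Fin 1 => if i.val + j.val + 1 = 1 then (1 : L) else 0)).Local v))) (((𝓘₂.K n).prod K₁ : Subgroup (↥(unitaryGroupOfForm (conjLocal L (IsCMField.complexConj L) v) (cmLocalForm L 2 v)) × ((cmDatum L 1 (Matrix.of fun i j : Fin 1 => if i.val + j.val + 1 = 1 then (1 : L) else 0)).Local v))))).indicator fun _ => (1 : ℂ)) (ConjClasses.mk (((tH : ↥(unitaryGroupOfForm (conjLocal L (IsCMField.complexConj L) v) (cmLocalForm L 2 v))) :
          ((cmDatum L 2 (Matrix.of fun i j : Fin 2 => if i.val + j.val + 1 = 2 then (1 : L) else 0)).Local v)), γH.2)) =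
        ((rootDeltaChar (cmBorelTriple L 2 v).P ⟨(tH : ↥(unitaryGroupOfForm (conjLocal L (IsCMField.complexConj L) v) (cmLocalForm L 2 v))), (cmBorelTriple L 2 v).M_le tH.2⟩ : ℂˣ) : ℂ)⁻¹ *
          (((letI : MeasurableSpace (LocalRing L v) := borel _; haveI : BorelSpace (LocalRing L v) := ⟨rfl⟩
            haveI : SecondCountableTopology (LocalRing L v) := secondCountableTopology_localRing (E := L) v
            ((HeisRing.skewModulus (conjLocal L (IsCMField.complexConj L) v) (continuous_conjLocal L (IsCMField.complexConj L) v) hb.unit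
              (LineRing.map_unit_torusScalar_sub_one_two (conjLocal L (IsCMField.complexConj L) v) (cmLocalForm_eq_over L 2 v)
                (⟨(tH : ↥(unitaryGroupOfForm (conjLocal L (IsCMField.complexConj L) v) (cmLocalForm L 2 v))), tH.2⟩ :
                  ↥(torusU (conjLocal L (IsCMField.complexConj L) v) (cmLocalForm L 2 v))) hdH hb))⁻¹ : ℝ≥0)) : ℝ) : ℂ) *
          (κH u * (((u • ((((𝓘₂.K n).comap (cmBorelTriple L 2 v).M.subtype).prod K₁ : Subgroup (↥(cmBorelTriple L 2 v).M × ((cmDatum L 1 (Matrix.of fun i j : Fin 1 => if i.val + j.val + 1 = 1 then (1 : L) else 0)).Local v))) : Set (↥(cmBorelTriple L 2 v).M × ((cmDatum L 1 (Matrix.of fun i j : Fin 1 => if i.val + j.val + 1 = 1 then (1 : L) else 0)).Local v))))).indicator (fun _ => (1 : ℂ)) (tH, γH.2) + κ' u * (C' u).indicator (fun _ => (1 : ℂ)) (tH, γH.2)))) ∧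
    (∀ u ∈ F, κH u ≠ 0) ∧
    (∀ u ∈ F, C' u = ((((⟨(w₀ * (u.1 : ↥(unitaryGroupOfForm (conjLocal L (IsCMField.complexConj L) v) (cmLocalForm L 2 v))) * w₀⁻¹), (weylConj_mem_cmTorus_two L v w₀ hw₀ u.1)⟩ : ↥(cmBorelTriple L 2 v).M), u.2) : (↥(cmBorelTriple L 2 v).M × ((cmDatum L 1 (Matrix.of fun i j : Fin 1 => if i.val + j.val + 1 = 1 then (1 : L) else 0)).Local v))) • ((((𝓘₂.K n).comap (cmBorelTriple L 2 v).M.subtype).prod K₁ : Subgroup (↥(cmBorelTriple L 2 v).M × ((cmDatum L 1 (Matrix.of fun i j : Fin 1 => if i.val + j.val + 1 = 1 then (1 : L) else 0)).Local v))) : Set (↥(cmBorelTriple L 2 v).M × ((cmDatum L 1 (Matrix.of fun i j : Fin 1 => if i.val + j.val + 1 = 1 then (1 : L) else 0)).Local v))))) ∧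
    (∀ u ∈ F, κ' u = 1) ∧
    (∀ u ∈ F, haveI := locallyCompactSpace_cmBorelU L 2 v; κH u = (((νH.real ((((𝓘₂.K n).prod (⊤ : Subgroup ((cmDatum L 1 (Matrix.of fun i j : Fin 1 => if i.val + j.val + 1 = 1 then (1 : L) else 0)).Local v)) : Subgroup (↥(unitaryGroupOfForm (conjLocal L (IsCMField.complexConj L) v) (cmLocalForm L 2 v)) × ((cmDatum L 1 (Matrix.of fun i j : Fin 1 => if i.val + j.val + 1 = 1 then (1 : L) else 0)).Local v))) : Set (↥(unitaryGroupOfForm (conjLocal L (IsCMField.complexConj L) v) (cmLocalForm L 2 v)) × ((cmDatum L 1 (Matrix.of fun i j : Fin 1 => if i.val + j.val + 1 = 1 then (1 : L) else 0)).Local v)))) : ℝ) : ℂ) * ((R₂ u).card : ℂ) * (((rootDeltaChar (cmBorelTriple L 2 v).P (Subgroup.inclusion (cmBorelTriple L 2 v).M_le ⟨(w₀ * (u.1 : ↥(unitaryGroupOfForm (conjLocal L (IsCMField.complexConj L) v) (cmLocalForm L 2 v))) * w₀⁻¹), (weylConj_mem_cmTorus_two L v w₀ hw₀ u.1)⟩))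 : ℂˣ) : ℂ) *
              ((μT.real {t : ↥(cmBorelTriple L 2 v).M | (t : ↥(unitaryGroupOfForm (conjLocal L (IsCMField.complexConj L) v) (cmLocalForm L 2 v))) ∈ cmLocalIntegralLevel L 2 (Matrix.of fun i j : Fin 2 => if i.val + j.val + 1 = 2 then (1 : L) else 0) v} : ℝ) : ℂ) /
              ((μT.real ((((𝓘₂.K n).comap (cmBorelTriple L 2 v).M.subtype : Subgroup ↥(cmBorelTriple L 2 v).M)) : Set ↥(cmBorelTriple L 2 v).M) : ℝ) : ℂ))) := by
  haveI : LocallyCompactSpace ↥(unitaryGroupOfForm (conjLocal L (IsCMField.complexConj L) v) (cmLocalForm L 2 v)) := locallyCompactSpace_local (IsCMField.complexConj L) 2 _ v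
  haveI := locallyCompactSpace_cmBorelU L 2 v
  haveI : T1Space (LocalRing L v) := inferInstance
  have hT₂cl := isClosed_torusU_of_t1Space (conjLocal L (IsCMField.complexConj L) v) (cmLocalForm L 2 v)
  haveI : CompactSpace ((cmDatum L 1 (Matrix.of fun i j : Fin 1 => if i.val + j.val + 1 = 1 then (1 : L) else 0)).Local v) :=
    compactSpace_cmDatum_local_one_of_smul_eq L _ w hw (isUnit_placeForm_antidiagOne (E := L) 1 w.1)
  have hK₁lev : ∀ x : ((cmDatum L 1 (Matrix.of fun i j : Fin 1 => if i.val + j.val + 1 = 1 then (1 : L) else 0)).Local v), x ∈ cmLocalIntegralLevel L 1 (Matrix.of fun i j : Fin 1 => if i.val + j.val + 1 = 1 then (1 : L) else 0) v := by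
    intro x
    rw [cmLocalIntegralLevel_one_eq_top_of_smul_eq L _ w hw (isUnit_placeForm_antidiagOne (E := L) 1 w.1)]
    exact Subgroup.mem_top x
  have hW2c := fun (χ₁ : (LocalRing L v)ˣ →* ℂˣ) (χ₂ : ↥(normOneUnits (conjLocal L (IsCMField.complexConj L) v)) →* ℂˣ)
      (h₁ : Continuous fun x => ((χ₁ x : ℂˣ) : ℂ)) (h₂ : Continuous fun x => ((χ₂ x : ℂˣ) : ℂ)) =>
    F0P3cU2PrincipalSeriesJacquetFiltration.u2PrincipalSeries_jacquetFiltration L v hns χ₁ χ₂ h₁ h₂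
  have hflipE : ∀ u ∈ F, ∃ e₀ e₁ : w.1.adicCompletion L, (((localNonsplitEquiv (IsCMField.complexConj L) (Matrix.of fun i j : Fin 2 => if i.val + j.val + 1 = 2 then (1 : L) else 0) (IsCMField.complexConj_ne_one L) w hw
            (w₀ * (u.1 : ↥(unitaryGroupOfForm (conjLocal L (IsCMField.complexConj L) v) (cmLocalForm L 2 v))) * w₀⁻¹) :
          ↥(unitaryGroupOfForm (galAdicCompletionMap (L := L) (IsCMField.complexConj L) hw) (placeForm (Matrix.of fun i j : Fin 2 => if i.val + j.val + 1 = 2 then (1 : L) else 0) w.1))) :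
          GL (Fin 2) (w.1.adicCompletion L)) : Matrix (Fin 2) (Fin 2) (w.1.adicCompletion L)) = Matrix.diagonal ![e₀, e₁] ∧ Valued.v e₀ < Valued.v e₁ := by
    intro u hu
    obtain ⟨d', hd', hlt⟩ := hrepF u hu
    obtain ⟨e₀, e₁, he, hlt', -, -⟩ := F0P3cStCharTSFlipDominant.exists_eq_diagonal_weylConj_of_oriented L v w hw hw₀ u.1 hd' hlt
    exact ⟨e₀, e₁, he, hlt'⟩
  have hdomF : ∀ u ∈ F,
      (∀ x ∈ 𝓘₂.K n ⊓ (cmBorelTriple L 2 v).N, (w₀ * (u.1 : ↥(unitaryGroupOfForm (conjLocal L (IsCMField.complexConj L) v) (cmLocalForm L 2 v))) * w₀⁻¹) * x * (w₀ * (u.1 : ↥(unitaryGroupOfForm (conjLocal L (IsCMField.complexConj L) v) (cmLocalForm L 2 v))) * w₀⁻¹)⁻¹ ∈ 𝓘₂.K n) ∧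
      (∀ x ∈ 𝓘₂.K n ⊓ 𝓘₂.Nbar, (w₀ * (u.1 : ↥(unitaryGroupOfForm (conjLocal L (IsCMField.complexConj L) v) (cmLocalForm L 2 v))) * w₀⁻¹)⁻¹ * x * (w₀ * (u.1 : ↥(unitaryGroupOfForm (conjLocal L (IsCMField.complexConj L) v) (cmLocalForm L 2 v))) * w₀⁻¹) ∈ 𝓘₂.K n ⊓ 𝓘₂.Nbar) ∧
      (∀ x ∈ (cmBorelTriple L 2 v).N, ∃ m : ℕ, ∀ m', m ≤ m' → (w₀ * (u.1 : ↥(unitaryGroupOfForm (conjLocal L (IsCMField.complexConj L) v) (cmLocalForm L 2 v))) * w₀⁻¹) ^ m' * x * ((w₀ * (u.1 : ↥(unitaryGroupOfForm (conjLocal L (IsCMField.complexConj L) v) (cmLocalForm L 2 v))) * w₀⁻¹) ^ m')⁻¹ ∈ 𝓘₂.K n) ∧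
      (∃ R₂ : Finset ↥(unitaryGroupOfForm (conjLocal L (IsCMField.complexConj L) v) (cmLocalForm L 2 v)), IsLeftTransversal (𝓘₂.K n) (𝓘₂.K n ⊓ ConjAct.toConjAct (w₀ * (u.1 : ↥(unitaryGroupOfForm (conjLocal L (IsCMField.complexConj L) v) (cmLocalForm L 2 v))) * w₀⁻¹) • 𝓘₂.K n) R₂) := by
    intro u hu
    obtain ⟨e₀, e₁, he, hlt'⟩ := hflipE u hu
    exact F0P3cStCharTSDomGeneralHPkg.domGeneralH_of_inst L v w hw hα0 hα1 𝓘₂ hK₂I hNbarI n _ he hlt'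
  choose! R₂ hR₂ using fun u (hu : u ∈ F) => (hdomF u hu).2.2.2
  have hOHjF := F0P3cStCharTSHshellGlue.hOHj_xig_of_hF1H L v w hw νH hmH μT hK₁lev 𝓘₂ n K₁ hK₁o hK₁c
    w₀ hw₀ hKw hW2c F (fun u hu => ⟨(hdomF u hu).1, (hdomF u hu).2.1, (hdomF u hu).2.2.1⟩) R₂ hR₂
  -- `κH u ≠ 0`: Haar positivity of the compact open boxes, `#R₂ ≠ 0`, `δ ≠ 0` (★ CONSTANTS helpers)
  have hC₂o : IsOpen ((((𝓘₂.K n).comap (cmBorelTriple L 2 v).M.subtype : Subgroup ↥(cmBorelTriple L 2 v).M)) : Set ↥(cmBorelTriple L 2 v).M) :=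
    (𝓘₂.isOpen_K n).preimage continuous_subtype_val
  have hC₂c : IsCompact ((((𝓘₂.K n).comap (cmBorelTriple L 2 v).M.subtype : Subgroup ↥(cmBorelTriple L 2 v).M)) : Set ↥(cmBorelTriple L 2 v).M) :=
    hT₂cl.isClosedEmbedding_subtypeVal.isCompact_preimage (𝓘₂.isCompact_K n)
  have hKtop_o : IsOpen ((((𝓘₂.K n).prod (⊤ : Subgroup ((cmDatum L 1 (Matrix.of fun i j : Fin 1 => if i.val + j.val + 1 = 1 then (1 : L) else 0)).Local v))) : Subgroup (↥(unitaryGroupOfForm (conjLocal L (IsCMField.complexConj L) v) (cmLocalForm L 2 v)) × ((cmDatum L 1 (Matrix.of fun i j : Fin 1 => if i.val + j.val + 1 = 1 then (1 : L) else 0)).Local v))) : Set (↥(unitaryGroupOfForm (conjLocal L (IsCMField.complexConj L) v) (cmLocalForm L 2 v)) × ((cmDatum L 1 (Matrix.of fun i j : Fin 1 => if i.val + j.val + 1 = 1 then (1 : L) else 0)).Local v))) :=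
    (𝓘₂.isOpen_K n).prod isOpen_univ
  have hKtop_c : IsCompact ((((𝓘₂.K n).prod (⊤ : Subgroup ((cmDatum L 1 (Matrix.of fun i j : Fin 1 => if i.val + j.val + 1 = 1 then (1 : L) else 0)).Local v))) : Subgroup (↥(unitaryGroupOfForm (conjLocal L (IsCMField.complexConj L) v) (cmLocalForm L 2 v)) × ((cmDatum L 1 (Matrix.of fun i j : Fin 1 => if i.val + j.val + 1 = 1 then (1 : L) else 0)).Local v))) : Set (↥(unitaryGroupOfForm (conjLocal L (IsCMField.complexConj L) v) (cmLocalForm L 2 v)) × ((cmDatum L 1 (Matrix.of fun i j : Fin 1 => if i.val + j.val + 1 = 1 then (1 : L) else 0)).Local v))) :=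
    (𝓘₂.isCompact_K n).prod isCompact_univ
  have hκHne : ∀ u ∈ F, (((νH.real ((((𝓘₂.K n).prod (⊤ : Subgroup ((cmDatum L 1 (Matrix.of fun i j : Fin 1 => if i.val + j.val + 1 = 1 then (1 : L) else 0)).Local v)) : Subgroup (↥(unitaryGroupOfForm (conjLocal L (IsCMField.complexConj L) v) (cmLocalForm L 2 v)) × ((cmDatum L 1 (Matrix.of fun i j : Fin 1 => if i.val + j.val + 1 = 1 then (1 : L) else 0)).Local v))) : Set (↥(unitaryGroupOfForm (conjLocal L (IsCMField.complexConj L) v) (cmLocalForm L 2 v)) × ((cmDatum L 1 (Matrix.of fun i j : Fin 1 => if i.val + j.val + 1 = 1 then (1 : L) else 0)).Local v)))) : ℝ) : ℂ) * ((R₂ u).card : ℂ) * (((rootDeltaChar (cmBorelTriple L 2 v).P (Subgroup.inclusion (cmBorelTriple L 2 v).M_le ⟨(w₀ * (u.1 : ↥(unitaryGroupOfForm (conjLocal L (IsCMField.complexConj L) v) (cmLocalForm L 2 v))) * w₀⁻¹), (weylConj_mem_cmTorus_two L v w₀ hw₀ u.1)⟩)) : ℂˣ) : ℂ) *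
              ((μT.real {t : ↥(cmBorelTriple L 2 v).M | (t : ↥(unitaryGroupOfForm (conjLocal L (IsCMField.complexConj L) v) (cmLocalForm L 2 v))) ∈ cmLocalIntegralLevel L 2 (Matrix.of fun i j : Fin 2 => if i.val + j.val + 1 = 2 then (1 : L) else 0) v} : ℝ) : ℂ) /
              ((μT.real ((((𝓘₂.K n).comap (cmBorelTriple L 2 v).M.subtype : Subgroup ↥(cmBorelTriple L 2 v).M)) : Set ↥(cmBorelTriple L 2 v).M) : ℝ) : ℂ)) ≠ 0 := by
    intro u hu
    refine div_ne_zero (mul_ne_zero (mul_ne_zero (mul_ne_zero ?_ ?_) ?_) ?_) ?_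
    · exact F0P3cStCharTSConstants.ofReal_measureReal_coe_subgroup_ne_zero νH _ hKtop_o hKtop_c
    · exact F0P3cStCharTSConstants.natCast_card_ne_zero_of_isLeftTransversal (hR₂ u hu)
    · exact Units.ne_zero _
    · exact Complex.ofReal_ne_zero.2 (F0P3cStCharTSConstants.measureReal_cmBorelM_inter_level_pos' L 2 v μT).ne'
    · exact F0P3cStCharTSConstants.ofReal_measureReal_coe_subgroup_ne_zero _ _ hC₂o hC₂c
  exact ⟨R₂, _, _, _, hR₂, hOHjF, hκHne, fun u _ => rfl, fun u _ => rfl, fun u _ => rfl⟩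

end Summit.HodgeConjecture.HodgeConjecture.Cruxes.H413.F0P3cStCharTSXIGHPackage

end
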